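import Summits.HodgeConjecture.HodgeConjecture.Theorems.VHCAbelianSchemesRoadNowhereDisplaceableDefs
import HarnessLib

/-!
# Scratch (plan-lens-HodgeAV-26512-negation g3, 2026-08-28; director-hodge g17 R17.60 (B)(d′)) — crux stmt-HodgeConjecture-26512, LINE N′, node (N-U)
# (O₁) TYPED AS A PREDICATE ON THE OBJECT: «`E` (print: a finite locally free resolution of `Ē_{a′}` on `Y`) is an `AdmTw′`-pinned twisted datum
# of a pinned-served class at `(D, θ₀)`» — flat, conjunct-by-conjunct form + the kernel-checked link «(O₁)(E) ∧ one non-jumping point of `q^*E` ⇒ (N-U♭) at the datum».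
research route conditional on HC_CM; not a corollary; nothing here proves (O₁) for any object, (N-U♭), (N-U), (S4), the crux, №4, HC_AV, HC_CM or HC.
NO `sorry` in this file. What is NOT typable tonight is the ARGUMENT `E := Ē_{a′}` itself (print's sheaf as a tree OBJECT): missing declarations listed in
the docstring of `IsPrintCarrierTyping` — library debt named, not worked around. A comment-level target for workfile v3 (LEAD 165), NOT a stub of record.
-/

noncomputable section

open CategoryTheory CategoryTheory.Limits AlgebraicGeometry Topology

namespace Summit.HodgeConjecture.HodgeConjecture.Cruxes.DiagLocalOfMarkmanPinnedForall.NowhereDisplaceable.TwoTorsion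

set_option linter.dupNamespace false

open Literature.AlgebraicGeometry Literature.AlgebraicGeometry.Motives Literature.AlgebraicGeometry.Motives.AbelianVariety
open Literature.AlgebraicGeometry.HodgeTheory Literature.AlgebraicGeometry.Markman2025
open Literature.AlgebraicGeometry.KTheory (IsBoundedVBComplex)
open Literature.AlgebraicTopology.SingularHomology
open Summit.HodgeConjecture.HodgeConjecture.Ring2.SemiregularRepresentatives
open Summit.HodgeConjecture.HodgeConjecture.Ring2.SemiregularRepresentatives.MoverTrap
open Summit.HodgeConjecture.HodgeConjecture.Ring2.SemiregularRepresentatives.NowhereDisplaceable (ProperJump DenseJump quotientPullbackComplex)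

/-- **(O₁) AS A PREDICATE — `IsPrintCarrierTyping C D θ₀ E`: the bounded complex `E` on the secant quotient `Y = D.Y` IS an `AdmTw′`-admissible
`B`-twisted datum pinned to `(h_Y(θ₀), γ)` for SOME pinned-served class `γ ∈ 𝔖^pin(D.Y.X, h_Y(θ₀))`.** For print: `E :=` a finite locally free resolution of
Markman's descended reflexive secant sheaf `Ē_{a′}` (`q^*Ē_{a′} ≅ 𝓔 ⊗ det(𝓔)^{−a′}`, `a′ r ≡ −1 (mod d+1)`; for LINE N′'s two-torsion route `a′` EVEN, e.g.
`(d, a′) = (6, 8)`), `B₀ := −c₁(Ē_{a′})/8d`, `γ :=` print's class `κ₃(Ē_{a′}) − c₃·h_Y(θ₀)³`. (O₁) — the STANDING CHEAPEST FALSIFIER of every line of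
crux 26512 — is `IsPrintCarrierTyping C D θ₀ E_print` at every non-hyperelliptic H-good datum; its conjuncts (see `isPrintCarrierTyping_iff`) are
separately attackable: (O₁-vb) `E` is a bounded complex of vector bundles; (O₁-adm) `AdmTw′ 6 D.Y.X I E` for a degree set `I ∋ 3` (the TYPED
semiregularity: `gluableSigmaAdmissible ∨ bfSingleAdmissible′` — print proves its own notion of semiregularity for `Ē`, §7–§8; agreement with the
typed notion is the risk); (O₁-B) `B₀` rational and algebraic; (O₁-κ) `κ_k(E, B₀) ∈ ℂ·h_Y(θ₀)^k` for `k ∈ I ∖ {3}` and `κ₃ = γ + c₃ h_Y(θ₀)³`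
(Markman Lemma 8.3.1-type shape); (O₁-served) `γ` pinned-served (rational, off `ℂ·θ³`, `q^*γ` a Weil class of `(J × Ĵ, φ_d)`; the anchor clauses hold
at every datum by `SecantQuotientDatum.isSecantQuotientAnchorWith_hY`). NOT TYPABLE TONIGHT: the argument `E_print` as a tree OBJECT — missing
declarations (library debt, named): (M1) the Poincaré bundle ∕ Fourier–Mukai–Orlov transform `Φ̃` on bounded complexes over `J × Ĵ`; (M2) the ideal sheaf
`I_{𝒵_C}` of a disjoint union of Abel–Jacobi translates as an `𝒪_J`-module (`Jacobian.abelSum` exists, its scheme-theoretic image ∕ ideal does not);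
(M3) the exterior product `⊠` of complexes on `J × J`; (M4) the determinant line bundle of a bounded complex and `φ_L` for it; (M5) `Ḡ`-equivariant
DESCENT of a linearised complex along the isogeny `q` (`quotientPullbackComplex` = pull-back exists; descent does not). With (M1)–(M5) the closed
`Prop` «(O₁)» is `∀ D θ₀, ¬hyp → H → pol → IsPrintCarrierTyping C D θ₀ (markmanCarrier D a′)`.
[cite: Markman2025SecantWeil, §1.1, §1.5, Lemma 8.3.1, §9.3 Lemma 9.3.5–9.3.6, Remark 9.3.7] [cite: Perry2026Semiregularity, Thm. 1.1 and Def. 2.4] -/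
def IsPrintCarrierTyping (C : ChernCharacterBetti) (D : SecantQuotientDatum) (θ₀ : complexBetti D.𝒥.J.X 2)
    (E : CochainComplex D.Y.X.left.Modules ℤ) : Prop :=
  ∃ γ ∈ secantQuotientServedClassesPinned D.Y.X (D.hY θ₀), ∃ 𝓓 : PinnedTwistedDatum C AdmTw' D.Y.X (D.hY θ₀) γ, 𝓓.E = E

/-- **(O₁) UNFOLDED, conjunct by conjunct** (the runnable form of the falsifier: each clause is a separate claim about the object `E`).
[cite: Markman2025SecantWeil, §1.5 and Lemma 9.3.6] [cite: Perry2026Semiregularity, Thm. 1.1] -/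
theorem isPrintCarrierTyping_iff (C : ChernCharacterBetti) (D : SecantQuotientDatum) (θ₀ : complexBetti D.𝒥.J.X 2)
    (E : CochainComplex D.Y.X.left.Modules ℤ) :
    IsPrintCarrierTyping C D θ₀ E ↔
      ∃ (hE : IsBoundedVBComplex E) (B₀ : complexBetti D.Y.X 2) (I : Finset ℕ) (c : ℕ → ℂ) (γ : complexBetti D.Y.X (2 * 3)),
        γ ∈ secantQuotientServedClassesPinned D.Y.X (D.hY θ₀) ∧ IsRationalClass B₀ ∧ B₀ ∈ algebraicClasses D.Y.X 1 ∧ 3 ∈ I ∧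
        AdmTw' 6 D.Y.X I E ∧
        expTwistClasses D.Y.X B₀ (fun j => chPerfect C D.Y.X E hE.isFiniteLocallyFree j) 3 = γ + c 3 • cupPowTwo (D.hY θ₀) 3 ∧
        ∀ k ∈ I, k ≠ 3 → expTwistClasses D.Y.X B₀ (fun j => chPerfect C D.Y.X E hE.isFiniteLocallyFree j) k = c k • cupPowTwo (D.hY θ₀) k := by
  constructor
  · rintro ⟨γ, hγ, 𝓓, rfl⟩
    exact ⟨𝓓.bounded, 𝓓.B₀, 𝓓.I, 𝓓.c, γ, hγ, 𝓓.B₀_rational, 𝓓.B₀_algebraic, 𝓓.three_mem, 𝓓.adm, 𝓓.kappa_three, 𝓓.kappa_of_ne⟩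
  · rintro ⟨hE, B₀, I, c, γ, hγ, hBr, hBa, h3, hA, hκ₃, hκ⟩
    exact ⟨γ, hγ, ⟨E, hE, B₀, hBr, hBa, I, h3, hA, c, hκ₃, hκ⟩, rfl⟩

/-- **(O₁)(E) ∧ «one non-jumping point of `q^*E`» ⇒ the (N-U♭) instance at `(D, θ₀)`** — the research content of (N-U) for print's object is exactly
(O₁)(`Ē_{a′}`) plus the two-torsion pencil (`PENCIL-26512-TWOTORSION.md` §2: at every non-hyperelliptic H-good datum the 4032 two-torsion points
`(b₁, φ_Θ c)`, `c ≠ 0`, of `J × Ĵ` do not jump for `q^*Ē_{a′}`, `a′` even). [cite: Markman2025SecantWeil, Remark 9.3.7] [cite: Mukai1978, §3] -/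
theorem oneNonJumpingPoint_of_typing {C : ChernCharacterBetti} {D : SecantQuotientDatum} {θ₀ : complexBetti D.𝒥.J.X 2}
    {E : CochainComplex D.Y.X.left.Modules ℤ} (hO : IsPrintCarrierTyping C D θ₀ E)
    (hp : ∃ p : D.P.Points ℂ, p ∉ extJumpLocus D.P (quotientPullbackComplex D E)) :
    ∃ γ ∈ secantQuotientServedClassesPinned D.Y.X (D.hY θ₀), ∃ 𝓓 : PinnedTwistedDatum C AdmTw' D.Y.X (D.hY θ₀) γ,
      ∃ p : D.P.Points ℂ, p ∉ extJumpLocus D.P (quotientPullbackComplex D 𝓓.E) := by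
  obtain ⟨γ, hγ, 𝓓, rfl⟩ := hO
  obtain ⟨p, hp⟩ := hp
  exact ⟨γ, hγ, 𝓓, p, hp⟩

/-- **The object-keyed form of (N-U♭)** — «at every End-trivial non-hyperelliptic H-good datum SOME bounded complex `E` on `Y` satisfies (O₁) and has a
non-jumping point upstairs» — and its LITERAL EQUIVALENCE with (N-U♭) (`stub_oneNonJumpingPoint_End` of `TwoTorsionRecut.lean`): typing (O₁) separately
from the pencil's conclusion REQUIRES naming the object (M1)–(M5); over existing declarations the two flatten into one statement (as (F0-b) did,
`printSheafHandleExists_iff`). [cite: Markman2025SecantWeil, Remark 9.3.7] -/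
def TypedCarrierNonJumpingEnd (C : ChernCharacterBetti) : Prop :=
  ∀ (D : SecantQuotientDatum) (θ₀ : complexBetti D.𝒥.J.X 2),
    ¬ D.𝒥.IsHyperelliptic → OrbitTranslatesDisjoint D.𝒥 D.G₁ D.G₂ → D.𝒥.J.IsPolarizationClassOf D.Θ θ₀ → EndTrivial D →
    ∃ E : CochainComplex D.Y.X.left.Modules ℤ, IsPrintCarrierTyping C D θ₀ E ∧
      ∃ p : D.P.Points ℂ, p ∉ extJumpLocus D.P (quotientPullbackComplex D E)

theorem typedCarrierNonJumpingEnd_iff_oneNonJumpingPoint (C : ChernCharacterBetti) :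
    TypedCarrierNonJumpingEnd C ↔
      ∀ (D : SecantQuotientDatum) (θ₀ : complexBetti D.𝒥.J.X 2),
        ¬ D.𝒥.IsHyperelliptic → OrbitTranslatesDisjoint D.𝒥 D.G₁ D.G₂ → D.𝒥.J.IsPolarizationClassOf D.Θ θ₀ → EndTrivial D →
        ∃ γ ∈ secantQuotientServedClassesPinned D.Y.X (D.hY θ₀), ∃ 𝓓 : PinnedTwistedDatum C AdmTw' D.Y.X (D.hY θ₀) γ,
          ∃ p : D.P.Points ℂ, p ∉ extJumpLocus D.P (quotientPullbackComplex D 𝓓.E) := by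
  constructor
  · intro h D θ₀ hnh hH hθ₀ hEnd
    obtain ⟨E, hO, hp⟩ := h D θ₀ hnh hH hθ₀ hEnd
    exact oneNonJumpingPoint_of_typing hO hp
  · intro h D θ₀ hnh hH hθ₀ hEnd
    obtain ⟨γ, hγ, 𝓓, p, hp⟩ := h D θ₀ hnh hH hθ₀ hEnd
    exact ⟨𝓓.E, ⟨γ, hγ, 𝓓, rfl⟩, p, hp⟩

end Summit.HodgeConjecture.HodgeConjecture.Cruxes.DiagLocalOfMarkmanPinnedForall.NowhereDisplaceable.TwoTorsion

end
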